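import Literature.MathematicalPhysics.QuantumFieldTheory.Balaban1983to89.T4ExteriorCovariance

/-!
# `Balaban1983to89.T4SummableDefect` — observable-level telescoping with a SUMMABLE ENVELOPE: the one-run defects need only a
# K-uniform summable majorant in the scale distance (not a geometric one), and the two-run input need only be the convergence
# of the mid-level expectations at each FIXED distance (no comparison schedule); then the continuum limit of the cell's
# observable class exists and equals the iterated limit `lim_m lim_K (mid-level expectation at distance m)`
# (cell `pub-balaban`, scoping sub-cell `t4`, fan-out lineage t4-ne1p-p3 = PROVER seat P3 of the spine estimate NE1′, assigned
# technique «observable-level telescoping», generation 8; journal row T4-O3.E-NE1′-PROVE-P3h*; ADDITIVE — a new leaf importing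
# `T4ExteriorCovariance` only; no existing module is modified)

HONEST FRAMING.  Finite four-torus, rung (B)+1 only: the `ε → 0` limit of the joint expectations of unit-scale averaged
gauge-invariant Wilson-loop variables on ONE torus of fixed physical size, along a Wilson scheme `D.scheme g₀` of a datum of
Bałaban type — NOT infinite volume, NOT a mass gap, NOT the Clay problem, NOT summit progress.  Every analytic input below is a
HYPOTHESIS SHAPE (`def … : Prop`) entering the theorems as an explicit binder and asserted of NO datum; (B), `BetaPertH`,
(B^μ) are not mentioned because nothing here consumes them — the shapes are statements about the data's densities which a
supplier would have to prove UNDER those antecedents (as the apex modules `T4ApexTelescope` §2 do for the geometric shapes).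
STATEMENTS AND QUANTIFIER BOOKKEEPING ONLY: §1 is real analysis of bare sequences (an `ε/3` iterated-limit lemma with a
uniformly summable tail), §2–§3 instantiate it on the cell's objects; every declaration is [folklore] and sorry-free.

CITATION HEADER (lean-in-tree rule).  No page of T. Bałaban's series (CMP 1983–89) or of any other source was newly read for
this module and no sentence is attributed to print here.  The objects used — `normDefect`, `midExpect`, `expectAt`,
`UniformGeomDefect`, `FirstDefectSummable`, `MidDiscrepancyRate`, `MidGoodBadRate`, `RunLadder`/`LadderGoodBadRate`
(`T4ObservableTelescopeTwoRun`, generations 2–3 of this lineage), `StepDefectBudget`/`StepCovBudget`/`UniformDefectBudget`/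
`UniformCovDefect` (`T4ExteriorCovariance`, generation 7), `T4CauchySum.InjectedRate`/`deltaAt` (cell node U1–U4 shapes) — are
re-used BY NAME with their own certified headers' provenance; the printed TEMPLATE behind the two-run shapes (C. King, CMP 102
(1986) 649–677 [King1986], Thm 3.4 (3.9)–(3.13) pp. 656–657, abelian Higgs d = 2, 3) is cited THERE and used nowhere here.  For Bałaban's four-dimensional
densities NONE of the shapes is printed ([Balaban1989LargeFieldII] p. 356 names loop-variable expectations only as deserving
"detailed analysis and further publication" — verbatim sentence carried by `T4Continuum` v3 / `Missing` §2, not re-quoted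
here).  ABSOLUTE RULE honoured: no programme-internal statement is a hypothesis-free input.

WHY THIS LEAF (record `t4/T4-EST-NE1p-P3.md` v8 §13).  Generation 7 located the technique's last currency (`UniformCovDefect`:
K-uniform mass-weighted exterior covariances GEOMETRIC in the scale distance `n`, ratio `r = L⁴θ₁σ`) and recorded [analysis,
(12d)] that at the BORDER `σ = L⁻¹` of `count_mul_cov_rate_border` the per-step budget is `n`-independent, so that only a
summable-in-the-distance envelope (coming from the large-field step weights along the synchronised runs) could remain — «a
summable-envelope variant of `UniformGeomDefect` is a different matching theorem …, NOT typed».  This leaf types it, and in a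
form needing NO schedule: the existing free-level route (`hasContinuumLimit_of_midMatching` / `_of_midDiscrepancyRate`) sums
the increments `⟨∏⟩_{K+1} − ⟨∏⟩_K` along a schedule `m(K) ≍ log K` trading the geometric far tail `r^{m(K)}` against the volume
`Λ^{m(K)}`; here instead, for each FIXED distance `m`, `|⟨∏⟩_K − ⟨∏⟩_{K'}| ≤ |mid_K(m) − mid_{K'}(m)| + 2·Σ_{n ≥ m} A n`, so
convergence of `K ↦ mid_K(m)` for every `m` and `Σ A < ∞` give the Cauchy property (`ε/3`).  Consequences: (i) the one-run
input weakens from GEOMETRIC to SUMMABLE (`UniformSummableDefect`; `UniformGeomDefect ⇒` it); (ii) the two-run input at a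
fixed distance, `MidLimits`, follows from `MidDiscrepancyRate` under an injected rate with NO schedule lemma and WITHOUT the
volume hypothesis `1 ≤ Λ` (at fixed `m` the factor `Λ^m` is a constant) — so generation 3's `hasContinuumLimit_of_midDiscrepancyRate`
/ `_of_goodBad` / `_of_ladder` and generation 7's `hasContinuumLimit_of_covDefect_ladder` hold with `UniformGeomDefect` /
`UniformCovDefect` replaced by their summable-envelope analogues and `hΛ` dropped (§2–§3); (iii) the continuum expectation is
identified as the ITERATED LIMIT `lim_{m→∞} lim_{K→∞} mid_K(m)` with the explicit rate `|lim − lim_K mid_K(m)| ≤ Σ_{n≥m} A n`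
(`abs_lim_sub_midLim_le`, `tendsto_midLim`).

WHAT IS NOT PROVED / VALUE.  Nothing analytic: `UniformSummableDefect`, `MidLimits`, `SummableDefectBudget`,
`SummableCovDefect` and every upstream shape are NOT PRINTED and NOT proved for Bałaban's densities; whether the large-field
step weights of the synchronised runs are summable in the scale distance (the cell's reading of what a border-rate supplier
would need, record §13, [heuristic]) is asserted nowhere.  Value = the summation half of the technique in its weakest typed
form, available BY NAME to any supplier; NOT summit progress.

## Contents
§1 bare real sequences — tail of a summable envelope bounds the far defects (`abs_sum_Ico_le_tsum_shift`); the iterated-limit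
   lemma (`exists_tendsto_of_envelope`); identification of the limit and its rate (`abs_lim_sub_lim_le_of_envelope`,
   `tendsto_lim_of_envelope`); fixed-distance convergence from summable consecutive differences beyond the distance
   (`exists_tendsto_of_dist_le_from`).
§2 the cell's shapes — `UniformSummableDefect` (⇐ `UniformGeomDefect`; ⇒ `FirstDefectSummable`), `MidLimits`
   (⇐ `MidDiscrepancyRate` under an injected rate, no schedule, no `Λ ≥ 1`), the existence theorem
   `hasContinuumLimit_of_summableDefect_midLimits`, the identification `tendsto_midLim`, and the corollaries from
   `MidDiscrepancyRate` / `MidGoodBadRate` / a run ladder, including the `hΛ`-free forms of generation 3's theorems.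
§3 supplier entries — `SummableDefectBudget` / `SummableCovDefect` (per-step (0.3)-term budgets with a summable envelope,
   currency-free resp. in the exterior-covariance currency) `⇒ UniformSummableDefect`; monotonicity of the step budget in its
   constant; `UniformDefectBudget ⇒ SummableDefectBudget`; end-to-end `hasContinuumLimit_of_summableCovDefect_ladder`.

Revision v1.1 (generation 18, journal row T4-O3.E-NE1′-PROVE-P3k*; cell NOTE «KING 1986 LOCATOR SLIP»): docstring-only bibliographic
fix in the CITATION HEADER — the King template's volume «CMP 103» corrected to Part I, CMP 102 (1986) 649–677 [King1986] (CMP 103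
(1986) 323–349 is Part II, *The infinite volume limit*); CONTEXT-only citation, no kernel content depends on it; every declaration
byte-identical to v1 (p189790).
-/

noncomputable section

open MeasureTheory Filter Topology
open scoped BigOperators

namespace Literature.MathematicalPhysics.QuantumFieldTheory.Balaban1983to89.T4SummableDefect

open T4ObservableTelescope T4ObservableTelescopeTwoRun T4UniformDefectWiring T4ExteriorCovariance T4Spectator

/-! ## §1 Bare real sequences: a summable envelope of the far defects and the iterated-limit lemma -/

section Real

/-- **TAIL BOUND.**  If `|u n| ≤ A n` for `n < K` with `A ≥ 0` summable, the far block `Σ_{m ≤ n < K} u n` is bounded by the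
envelope's tail `Σ_{n ≥ m} A n = Σ' n, A (n + m)`, uniformly in `K`. [folklore] -/
theorem abs_sum_Ico_le_tsum_shift {u A : ℕ → ℝ} (hA0 : ∀ n, 0 ≤ A n) (hA : Summable A) {K : ℕ} (m : ℕ)
    (hu : ∀ n, n < K → |u n| ≤ A n) : |∑ n ∈ Finset.Ico m K, u n| ≤ ∑' n, A (n + m) := by
  have hs : Summable fun n => A (n + m) := (summable_nat_add_iff m).mpr hA
  calc |∑ n ∈ Finset.Ico m K, u n| ≤ ∑ n ∈ Finset.Ico m K, |u n| := Finset.abs_sum_le_sum_abs _ _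
    _ ≤ ∑ n ∈ Finset.Ico m K, A n := Finset.sum_le_sum fun n hn => hu n (Finset.mem_Ico.mp hn).2
    _ = ∑ i ∈ Finset.range (K - m), A (i + m) := by
        rw [Finset.sum_Ico_eq_sum_range]
        exact Finset.sum_congr rfl fun i _ => by rw [Nat.add_comm]
    _ ≤ ∑' n, A (n + m) := hs.sum_le_tsum _ fun i _ => hA0 _

/-- The envelope's tail is nonnegative. [folklore] -/
theorem tsum_shift_nonneg {A : ℕ → ℝ} (hA0 : ∀ n, 0 ≤ A n) (m : ℕ) : 0 ≤ ∑' n, A (n + m) :=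
  tsum_nonneg fun n => hA0 (n + m)

/-- The envelope's tail tends to zero. [folklore] -/
theorem tendsto_tsum_shift (A : ℕ → ℝ) : Tendsto (fun m => ∑' n, A (n + m)) atTop (𝓝 0) :=
  tendsto_sum_nat_add A

/-- **THE ITERATED-LIMIT LEMMA (ε/3).**  Let `E K = M K m + Σ_{m ≤ n < K} u K n` for all `m ≤ K` (a run's expectation = its
mid-level expectation at distance `m` + the far defects), `|u K n| ≤ A n` for `n < K` with `A ≥ 0` summable (a K-UNIFORM
SUMMABLE ENVELOPE), and suppose that for every fixed `m` the mid-level values `K ↦ M K m` converge.  Then `E` converges: given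
`ε`, choose `m` with tail `< ε/3`, then `K, K'` large for `M · m`. No schedule, no geometric rate. [folklore] -/
theorem exists_tendsto_of_envelope {E : ℕ → ℝ} {M u : ℕ → ℕ → ℝ} {A : ℕ → ℝ}
    (hE : ∀ K m, m ≤ K → E K = M K m + ∑ n ∈ Finset.Ico m K, u K n)
    (hA0 : ∀ n, 0 ≤ A n) (hA : Summable A) (hu : ∀ K n, n < K → |u K n| ≤ A n)
    (hM : ∀ m, ∃ ℓ : ℝ, Tendsto (fun K => M K m) atTop (𝓝 ℓ)) :
    ∃ l : ℝ, Tendsto E atTop (𝓝 l) := by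
  refine cauchySeq_tendsto_of_complete (Metric.cauchySeq_iff.2 fun ε hε => ?_)
  have hε3 : 0 < ε / 3 := by positivity
  obtain ⟨m, hm⟩ := (Metric.tendsto_atTop.mp (tendsto_tsum_shift A)) (ε / 3) hε3
  have hTm : ∑' n, A (n + m) < ε / 3 := by
    have h := hm m le_rfl
    rwa [Real.dist_eq, sub_zero, abs_of_nonneg (tsum_shift_nonneg hA0 m)] at h
  obtain ⟨ℓ, hℓ⟩ := hM m
  obtain ⟨N, hN⟩ := Metric.cauchySeq_iff.1 hℓ.cauchySeq (ε / 3) hε3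
  refine ⟨max N m, fun K hK K' hK' => ?_⟩
  have hKm : m ≤ K := (le_max_right N m).trans hK
  have hK'm : m ≤ K' := (le_max_right N m).trans hK'
  have h1 := hN K ((le_max_left N m).trans hK) K' ((le_max_left N m).trans hK')
  rw [Real.dist_eq] at h1 ⊢
  have h2 := abs_sum_Ico_le_tsum_shift hA0 hA m (hu K)
  have h3 := abs_sum_Ico_le_tsum_shift hA0 hA m (hu K')
  rw [hE K m hKm, hE K' m hK'm]
  obtain ⟨h1l, h1r⟩ := abs_lt.mp h1
  obtain ⟨h2l, h2r⟩ := abs_le.mp h2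
  obtain ⟨h3l, h3r⟩ := abs_le.mp h3
  exact abs_lt.mpr ⟨by linarith, by linarith⟩

/-- **RATE OF THE IDENTIFICATION.**  Under the same decomposition and envelope, if `E → l` and `M · m → ℓ` then
`|l − ℓ| ≤ Σ_{n ≥ m} A n`: the limit of the mid-level values at distance `m` misses the limit by at most the envelope's tail.
[folklore] -/
theorem abs_lim_sub_lim_le_of_envelope {E : ℕ → ℝ} {M u : ℕ → ℕ → ℝ} {A : ℕ → ℝ}
    (hE : ∀ K m, m ≤ K → E K = M K m + ∑ n ∈ Finset.Ico m K, u K n)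
    (hA0 : ∀ n, 0 ≤ A n) (hA : Summable A) (hu : ∀ K n, n < K → |u K n| ≤ A n)
    {l : ℝ} (hl : Tendsto E atTop (𝓝 l)) {m : ℕ} {ℓ : ℝ} (hℓ : Tendsto (fun K => M K m) atTop (𝓝 ℓ)) :
    |l - ℓ| ≤ ∑' n, A (n + m) := by
  have hlim : Tendsto (fun K => |E K - M K m|) atTop (𝓝 |l - ℓ|) := (hl.sub hℓ).abs
  refine le_of_tendsto hlim (Filter.eventually_atTop.2 ⟨m, fun K hK => ?_⟩)
  rw [hE K m hK, add_sub_cancel_left]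
  exact abs_sum_Ico_le_tsum_shift hA0 hA m (hu K)

/-- **THE LIMIT IS THE ITERATED LIMIT**: if moreover `M · m → ℓ m` for every `m`, then `ℓ m → l` as `m → ∞`. [folklore] -/
theorem tendsto_lim_of_envelope {E : ℕ → ℝ} {M u : ℕ → ℕ → ℝ} {A : ℕ → ℝ}
    (hE : ∀ K m, m ≤ K → E K = M K m + ∑ n ∈ Finset.Ico m K, u K n)
    (hA0 : ∀ n, 0 ≤ A n) (hA : Summable A) (hu : ∀ K n, n < K → |u K n| ≤ A n)
    {l : ℝ} (hl : Tendsto E atTop (𝓝 l)) {ℓ : ℕ → ℝ} (hℓ : ∀ m, Tendsto (fun K => M K m) atTop (𝓝 (ℓ m))) :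
    Tendsto ℓ atTop (𝓝 l) := by
  have h0 : Tendsto (fun m => ℓ m - l) atTop (𝓝 0) := by
    refine squeeze_zero_norm (fun m => ?_) (tendsto_tsum_shift A)
    rw [Real.norm_eq_abs, abs_sub_comm]
    exact abs_lim_sub_lim_le_of_envelope hE hA0 hA hu hl (hℓ m)
  have h := h0.add_const l
  simpa using h

/-- **FIXED-DISTANCE CONVERGENCE FROM SUMMABLE CONSECUTIVE DIFFERENCES BEYOND THE DISTANCE**: if
`|f (K+1) − f K| ≤ d (K − m)` for all `K ≥ m` with `d` summable (a bound available only once the run is at least `m` steps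
long), then `f` converges. [folklore] -/
theorem exists_tendsto_of_dist_le_from {f : ℕ → ℝ} {d : ℕ → ℝ} (m : ℕ) (hd : Summable d)
    (h : ∀ K, m ≤ K → |f (K + 1) - f K| ≤ d (K - m)) : ∃ ℓ : ℝ, Tendsto f atTop (𝓝 ℓ) := by
  have hc : CauchySeq fun j => f (j + m) := by
    refine cauchySeq_of_dist_le_of_summable d (fun j => ?_) hd
    rw [Real.dist_eq, abs_sub_comm, show j + 1 + m = j + m + 1 by omega]
    simpa [Nat.add_sub_cancel] using h (j + m) (Nat.le_add_left m j)
  obtain ⟨ℓ, hℓ⟩ := cauchySeq_tendsto_of_complete hc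
  exact ⟨ℓ, (tendsto_add_atTop_iff_nat m).mp hℓ⟩

/-- Polynomial-times-geometric majorants shifted by a fixed distance are summable:
`Σ_j ((j + m) + 1)^p · q^j < ∞` for `0 ≤ q < 1` (via `(j + m + 1) ≤ (m + 1)(j + 1)`). [folklore] -/
theorem summable_shift_pow_mul_geometric {q : ℝ} (hq0 : 0 ≤ q) (hq1 : q < 1) (p m : ℕ) :
    Summable (fun j : ℕ => (((j + m : ℕ) : ℝ) + 1) ^ p * q ^ j) := by
  have hs := (T4CauchySum.summable_succ_pow_mul_geometric hq0 hq1 p).mul_left (((m : ℝ) + 1) ^ p)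
  refine Summable.of_nonneg_of_le (fun j => mul_nonneg (pow_nonneg (by positivity) _) (pow_nonneg hq0 _))
    (fun j => ?_) hs
  have hle : ((j + m : ℕ) : ℝ) + 1 ≤ ((m : ℝ) + 1) * ((j : ℝ) + 1) := by
    push_cast
    nlinarith [Nat.cast_nonneg (α := ℝ) j, Nat.cast_nonneg (α := ℝ) m]
  have h0 : 0 ≤ ((j + m : ℕ) : ℝ) + 1 := by positivity
  calc (((j + m : ℕ) : ℝ) + 1) ^ p * q ^ j ≤ (((m : ℝ) + 1) * ((j : ℝ) + 1)) ^ p * q ^ j :=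
        mul_le_mul_of_nonneg_right (pow_le_pow_left₀ h0 hle p) (pow_nonneg hq0 _)
    _ = ((m : ℝ) + 1) ^ p * (((j : ℝ) + 1) ^ p * q ^ j) := by rw [mul_pow]; ring

end Real

/-! ## §2 The cell's shapes: summable envelope + mid-level limits ⇒ existence, and the identification of the limit -/

section Cell

open T4Continuum Missing T4CauchySum

variable {F : T4Family} {G : Type*} [GaugeGroup G] [MeasurableSpace G] [HaarData G]

/-- HYPOTHESIS SHAPE — K-UNIFORM SUMMABLE ENVELOPE OF THE ONE-RUN DEFECTS: per string of labels there is `A ≥ 0` with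
`Σ A < ∞` and `|normDefect D g₀ K Cs n| ≤ A n` for all `n < K` — the far defects of every run are dominated by ONE summable
sequence in the scale distance.  Weaker than `UniformGeomDefect` (`A n = C·rⁿ`); the shape a border-rate supplier
(`σ = L⁻¹` in generation 7's covariance currency, per-step constants carrying a summable-in-the-distance large-field weight)
would meet.  NOT PRINTED, never asserted. [folklore] -/
def UniformSummableDefect (D : FiniteEpsData F G) (g₀ : ℕ → ℝ) : Prop :=
  ∀ Cs : List (ULoop F), ∃ A : ℕ → ℝ, (∀ n, 0 ≤ A n) ∧ Summable A ∧ ∀ K n, n < K → |normDefect D g₀ K Cs n| ≤ A n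

/-- `UniformGeomDefect ⇒ UniformSummableDefect` (`A n = C·rⁿ`). [folklore] -/
theorem uniformSummableDefect_of_uniformGeomDefect (D : FiniteEpsData F G) (g₀ : ℕ → ℝ)
    (h : UniformGeomDefect D g₀) : UniformSummableDefect D g₀ := by
  intro Cs
  obtain ⟨C, r, hC, hr0, hr1, hK⟩ := h Cs
  exact ⟨fun n => C * r ^ n, fun n => mul_nonneg hC (pow_nonneg hr0 n),
    (summable_geometric_of_lt_one hr0 hr1).mul_left C, hK⟩

/-- `UniformSummableDefect ⇒ FirstDefectSummable` (the longer run's first step is at distance `K`: `c K = A K`). [folklore] -/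
theorem firstDefectSummable_of_uniformSummableDefect (D : FiniteEpsData F G) (g₀ : ℕ → ℝ)
    (h : UniformSummableDefect D g₀) : FirstDefectSummable D g₀ := by
  intro Cs
  obtain ⟨A, _, hA, hK⟩ := h Cs
  exact ⟨A, hA, abs_first_le_of_uniform (u := fun K n => normDefect D g₀ K Cs n) hK⟩

/-- **ONE RUN, FAR TAIL**: under a summable envelope, `|⟨∏⟩_K − mid_K(m)| ≤ Σ_{n ≥ m} A n` for every `m ≤ K`
(`expectAt_eq_midExpect_add_sum` + `abs_sum_Ico_le_tsum_shift`). [folklore] -/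
theorem abs_expectAt_sub_midExpect_le [RegularGaugeGroup G] (D : FiniteEpsData F G) (hM : D.AvgMeasurable)
    (g₀ : ℕ → ℝ) (Cs : List (ULoop F)) {A : ℕ → ℝ} (hA0 : ∀ n, 0 ≤ A n) (hA : Summable A)
    (hK : ∀ K n, n < K → |normDefect D g₀ K Cs n| ≤ A n) {K m : ℕ} (hm : m ≤ K) :
    |(D.scheme g₀).expectAt K Cs - midExpect D g₀ K Cs m| ≤ ∑' n, A (n + m) := by
  rw [expectAt_eq_midExpect_add_sum D hM g₀ Cs hm, add_sub_cancel_left]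
  exact abs_sum_Ico_le_tsum_shift hA0 hA m (hK K)

/-- HYPOTHESIS SHAPE — MID-LEVEL LIMITS AT EVERY FIXED DISTANCE: per string and per distance `m`, the mid-level expectations
`K ↦ midExpect D g₀ K Cs m` (the loop product pulled back `m` levels, integrated against run `K`'s density at level `K − m`,
normalised) CONVERGE as `K → ∞` — the `ε → 0` limit of the effective expectation at the FIXED PHYSICAL comparison scale
`L^{−m}`.  Cell reading: node U5 undressed at a fixed distance from the end (a (B^μ)-type convergence of the effective
densities seen by one bounded functional); implied by `MidDiscrepancyRate` under an injected rate
(`midLimits_of_midDiscrepancyRate`).  HONEST RANGE: at `m = 0` it is the convergence of the final-density expectations; it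
does NOT contain the Cauchy property of the expectations themselves (that would be «`m = K`», which is not a fixed distance).
NOT PRINTED for Bałaban's densities, never asserted. [folklore] -/
def MidLimits (D : FiniteEpsData F G) (g₀ : ℕ → ℝ) : Prop :=
  ∀ (Cs : List (ULoop F)) (m : ℕ), ∃ ℓ : ℝ, Tendsto (fun K => midExpect D g₀ K Cs m) atTop (𝓝 ℓ)

/-- **THE EXISTENCE THEOREM OF THIS LEAF: summable envelope + mid-level limits ⇒ `Missing.HasContinuumLimit (D.scheme g₀)`**
(the iterated-limit lemma `exists_tendsto_of_envelope` on `expectAt_eq_midExpect_add_sum`).  CONDITIONAL on the two shapes,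
neither printed nor proved for Bałaban's densities. [folklore] -/
theorem hasContinuumLimit_of_summableDefect_midLimits [RegularGaugeGroup G] (D : FiniteEpsData F G)
    (hM : D.AvgMeasurable) (g₀ : ℕ → ℝ) (hU : UniformSummableDefect D g₀) (hL : MidLimits D g₀) :
    HasContinuumLimit (D.scheme g₀) := by
  intro Cs
  obtain ⟨A, hA0, hA, hK⟩ := hU Cs
  exact exists_tendsto_of_envelope (M := fun K m => midExpect D g₀ K Cs m) (u := fun K n => normDefect D g₀ K Cs n)
    (fun _ _ hm => expectAt_eq_midExpect_add_sum D hM g₀ Cs hm) hA0 hA hK (hL Cs)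

/-- **RATE OF THE IDENTIFICATION for the cell**: `|lim_K ⟨∏⟩_K − lim_K mid_K(m)| ≤ Σ_{n ≥ m} A n`. [folklore] -/
theorem abs_lim_sub_midLim_le [RegularGaugeGroup G] (D : FiniteEpsData F G) (hM : D.AvgMeasurable) (g₀ : ℕ → ℝ)
    (Cs : List (ULoop F)) {A : ℕ → ℝ} (hA0 : ∀ n, 0 ≤ A n) (hA : Summable A)
    (hK : ∀ K n, n < K → |normDefect D g₀ K Cs n| ≤ A n) {l : ℝ}
    (hl : Tendsto (fun K => (D.scheme g₀).expectAt K Cs) atTop (𝓝 l)) {m : ℕ} {ℓ : ℝ}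
    (hℓ : Tendsto (fun K => midExpect D g₀ K Cs m) atTop (𝓝 ℓ)) : |l - ℓ| ≤ ∑' n, A (n + m) :=
  abs_lim_sub_lim_le_of_envelope (M := fun K m => midExpect D g₀ K Cs m) (u := fun K n => normDefect D g₀ K Cs n)
    (fun _ _ hm => expectAt_eq_midExpect_add_sum D hM g₀ Cs hm) hA0 hA hK hl hℓ

/-- **THE CONTINUUM EXPECTATION IS THE ITERATED LIMIT `lim_m lim_K mid_K(m)`**: if the expectations converge to `l` and the
mid-level expectations at distance `m` converge to `ℓ m` for every `m`, then `ℓ m → l`. [folklore] -/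
theorem tendsto_midLim [RegularGaugeGroup G] (D : FiniteEpsData F G) (hM : D.AvgMeasurable) (g₀ : ℕ → ℝ)
    (Cs : List (ULoop F)) {A : ℕ → ℝ} (hA0 : ∀ n, 0 ≤ A n) (hA : Summable A)
    (hK : ∀ K n, n < K → |normDefect D g₀ K Cs n| ≤ A n) {l : ℝ}
    (hl : Tendsto (fun K => (D.scheme g₀).expectAt K Cs) atTop (𝓝 l)) {ℓ : ℕ → ℝ}
    (hℓ : ∀ m, Tendsto (fun K => midExpect D g₀ K Cs m) atTop (𝓝 (ℓ m))) : Tendsto ℓ atTop (𝓝 l) :=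
  tendsto_lim_of_envelope (M := fun K m => midExpect D g₀ K Cs m) (u := fun K n => normDefect D g₀ K Cs n)
    (fun _ _ hm => expectAt_eq_midExpect_add_sum D hM g₀ Cs hm) hA0 hA hK hl hℓ

/-- **`MidDiscrepancyRate ⇒ MidLimits`, NO SCHEDULE, NO `Λ ≥ 1`**: at a fixed distance `m`, for `K ≥ m`,
`|mid_{K+1}(m) − mid_K(m)| ≤ V·Λ^m·deltaAt E ρ inj K (K − m) ≤ |V·Λ^m|·E·C·(K+1)^{c+1}·max(θ,ρ)^{K−m}` (`deltaAt_le`), summable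
in `K` (`summable_shift_pow_mul_geometric`), hence convergence (`exists_tendsto_of_dist_le_from`). [folklore] -/
theorem midLimits_of_midDiscrepancyRate (D : FiniteEpsData F G) (g₀ : ℕ → ℝ) {C θ E ρ Λ : ℝ} {c : ℕ}
    {inj : ℕ → ℕ → ℝ} (hinj : InjectedRate C c θ inj) (hE : 0 ≤ E) (hθ : 0 ≤ θ) (hθ1 : θ < 1) (hρ : 0 ≤ ρ)
    (hρ1 : ρ < 1) (h : MidDiscrepancyRate D g₀ Λ E ρ inj) : MidLimits D g₀ := by
  intro Cs m
  obtain ⟨V, _, hK⟩ := h Cs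
  have hq0 : 0 ≤ max θ ρ := hθ.trans (le_max_left _ _)
  have hq1 : max θ ρ < 1 := max_lt hθ1 hρ1
  have hC0 : 0 ≤ C := by simpa using hinj.const_nonneg 0
  have hEC : 0 ≤ E * C := mul_nonneg hE hC0
  refine exists_tendsto_of_dist_le_from m
    ((summable_shift_pow_mul_geometric hq0 hq1 (c + 1) m).mul_left (|V * Λ ^ m| * (E * C))) fun K hmK => ?_
  obtain ⟨j, rfl⟩ := Nat.exists_eq_add_of_le' hmK
  have hδ0 : 0 ≤ deltaAt E ρ inj (j + m) j := deltaAt_nonneg hinj hE hρ (Nat.le_add_right j m)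
  have hδ := deltaAt_le hinj hE hθ hρ (K := j + m) (k := j) (Nat.le_add_right j m)
  calc |midExpect D g₀ (j + m + 1) Cs m - midExpect D g₀ (j + m) Cs m|
      ≤ V * Λ ^ m * deltaAt E ρ inj (j + m) (j + m - m) := hK (j + m) m hmK
    _ = V * Λ ^ m * deltaAt E ρ inj (j + m) j := by rw [Nat.add_sub_cancel]
    _ ≤ |V * Λ ^ m| * deltaAt E ρ inj (j + m) j := mul_le_mul_of_nonneg_right (le_abs_self _) hδ0
    _ ≤ |V * Λ ^ m| * (E * C * (((j + m : ℕ) : ℝ) + 1) ^ (c + 1) * (max θ ρ) ^ j) :=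
        mul_le_mul_of_nonneg_left (by exact_mod_cast hδ) (abs_nonneg _)
    _ = |V * Λ ^ m| * (E * C) * ((((j + m : ℕ) : ℝ) + 1) ^ (c + 1) * (max θ ρ) ^ j) := by ring
    _ = |V * Λ ^ m| * (E * C) * ((((j + m - m + m : ℕ) : ℝ) + 1) ^ (c + 1) * (max θ ρ) ^ (j + m - m)) := by
        rw [Nat.add_sub_cancel]

/-- **EXISTENCE FROM A SUMMABLE ENVELOPE AND A MID-LEVEL DISCREPANCY RATE** (strict weakening of generation 3's
`hasContinuumLimit_of_midDiscrepancyRate`: geometric ⇒ summable on the one-run side, schedule and `1 ≤ Λ` dropped).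
CONDITIONAL on the two shapes, neither printed nor proved for Bałaban's densities. [folklore] -/
theorem hasContinuumLimit_of_summableDefect_midRate [RegularGaugeGroup G] (D : FiniteEpsData F G)
    (hM : D.AvgMeasurable) (g₀ : ℕ → ℝ) (hU : UniformSummableDefect D g₀) {C θ E ρ Λ : ℝ} {c : ℕ}
    {inj : ℕ → ℕ → ℝ} (hinj : InjectedRate C c θ inj) (hE : 0 ≤ E) (hθ : 0 ≤ θ) (hθ1 : θ < 1) (hρ : 0 ≤ ρ)
    (hρ1 : ρ < 1) (h : MidDiscrepancyRate D g₀ Λ E ρ inj) : HasContinuumLimit (D.scheme g₀) :=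
  hasContinuumLimit_of_summableDefect_midLimits D hM g₀ hU (midLimits_of_midDiscrepancyRate D g₀ hinj hE hθ hθ1 hρ hρ1 h)

/-- The same from the density-level good/bad datum at the free level (`midDiscrepancyRate_of_goodBad`). [folklore] -/
theorem hasContinuumLimit_of_summableDefect_goodBad [RegularGaugeGroup G] (D : FiniteEpsData F G)
    (hM : D.AvgMeasurable) (g₀ : ℕ → ℝ) (hU : UniformSummableDefect D g₀) {C θ E ρ Λ : ℝ} {c : ℕ}
    {inj : ℕ → ℕ → ℝ} (hinj : InjectedRate C c θ inj) (hE : 0 ≤ E) (hθ : 0 ≤ θ) (hθ1 : θ < 1) (hρ : 0 ≤ ρ)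
    (hρ1 : ρ < 1) (h : MidGoodBadRate D g₀ Λ E ρ inj) : HasContinuumLimit (D.scheme g₀) :=
  hasContinuumLimit_of_summableDefect_midRate D hM g₀ hU hinj hE hθ hθ1 hρ hρ1 (midDiscrepancyRate_of_goodBad D hM g₀ h)

/-- The same along a run ladder (`midGoodBadRate_of_ladder`). [folklore] -/
theorem hasContinuumLimit_of_summableDefect_ladder [RegularGaugeGroup G] (D : FiniteEpsData F G)
    (hM : D.AvgMeasurable) (R : RunLadder D) (g₀ : ℕ → ℝ) (hU : UniformSummableDefect D g₀) {C θ E ρ Λ : ℝ} {c : ℕ}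
    {inj : ℕ → ℕ → ℝ} (hinj : InjectedRate C c θ inj) (hE : 0 ≤ E) (hθ : 0 ≤ θ) (hθ1 : θ < 1) (hρ : 0 ≤ ρ)
    (hρ1 : ρ < 1) (h : LadderGoodBadRate D R g₀ Λ E ρ inj) : HasContinuumLimit (D.scheme g₀) :=
  hasContinuumLimit_of_summableDefect_goodBad D hM g₀ hU hinj hE hθ hθ1 hρ hρ1 (midGoodBadRate_of_ladder D R g₀ h)

/-- REMARK — generation 3's route WITHOUT the volume hypothesis: `UniformGeomDefect` + `MidDiscrepancyRate` under an injected
rate ⇒ existence for EVERY real `Λ` (the hypothesis `1 ≤ Λ` of `hasContinuumLimit_of_midDiscrepancyRate` served only the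
schedule lemma). [folklore] -/
theorem hasContinuumLimit_of_midDiscrepancyRate_anyVolume [RegularGaugeGroup G] (D : FiniteEpsData F G)
    (hM : D.AvgMeasurable) (g₀ : ℕ → ℝ) (hU : UniformGeomDefect D g₀) {C θ E ρ Λ : ℝ} {c : ℕ}
    {inj : ℕ → ℕ → ℝ} (hinj : InjectedRate C c θ inj) (hE : 0 ≤ E) (hθ : 0 ≤ θ) (hθ1 : θ < 1) (hρ : 0 ≤ ρ)
    (hρ1 : ρ < 1) (h : MidDiscrepancyRate D g₀ Λ E ρ inj) : HasContinuumLimit (D.scheme g₀) :=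
  hasContinuumLimit_of_summableDefect_midRate D hM g₀ (uniformSummableDefect_of_uniformGeomDefect D g₀ hU)
    hinj hE hθ hθ1 hρ hρ1 h

/-- REMARK — the ladder form of generation 3 / 7 without the volume hypothesis. [folklore] -/
theorem hasContinuumLimit_of_ladder_anyVolume [RegularGaugeGroup G] (D : FiniteEpsData F G) (hM : D.AvgMeasurable)
    (R : RunLadder D) (g₀ : ℕ → ℝ) (hU : UniformGeomDefect D g₀) {C θ E ρ Λ : ℝ} {c : ℕ} {inj : ℕ → ℕ → ℝ}
    (hinj : InjectedRate C c θ inj) (hE : 0 ≤ E) (hθ : 0 ≤ θ) (hθ1 : θ < 1) (hρ : 0 ≤ ρ) (hρ1 : ρ < 1)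
    (h : LadderGoodBadRate D R g₀ Λ E ρ inj) : HasContinuumLimit (D.scheme g₀) :=
  hasContinuumLimit_of_summableDefect_ladder D hM R g₀ (uniformSummableDefect_of_uniformGeomDefect D g₀ hU)
    hinj hE hθ hθ1 hρ hρ1 h

end Cell

/-! ## §3 Supplier entries: per-step term budgets with a summable envelope ⇒ the summable-envelope shape -/

section Supplier

open T4Continuum Missing T4CauchySum

variable {F : T4Family} {G : Type*} [GaugeGroup G] [MeasurableSpace G] [HaarData G]
variable [∀ K j : ℕ, DecidableEq (PBond (F.P K) j)]

/-- The currency-free step budget is MONOTONE in its constant (`∫ρ_K ≥ 0`): a supplier holding a budget `a k n` for step `k`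
at distance `n` dominated by an envelope `A n` holds the budget `A n`. [folklore] -/
theorem stepDefectBudget_mono [RegularGaugeGroup G] (D : FiniteEpsData F G) (g₀ : ℕ → ℝ) (Cs : List (ULoop F))
    {a a' : ℝ} (hle : a ≤ a') {k n : ℕ} (h : StepDefectBudget D g₀ Cs a k n) : StepDefectBudget D g₀ Cs a' k n := by
  obtain ⟨ρr, hbud⟩ := h
  exact ⟨ρr, hbud.trans (mul_le_mul_of_nonneg_right hle (integral_rho_pos D (k + 1 + n) (g₀ (k + 1 + n))).le)⟩

/-- The covariance-currency step budget is monotone in its constant. [folklore] -/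
theorem stepCovBudget_mono [RegularGaugeGroup G] (D : FiniteEpsData F G) (g₀ : ℕ → ℝ) (Cs : List (ULoop F))
    {a a' : ℝ} (hle : a ≤ a') {k n : ℕ} (h : StepCovBudget D g₀ Cs a k n) : StepCovBudget D g₀ Cs a' k n := by
  obtain ⟨ρr, cs, hbud⟩ := h
  exact ⟨ρr, cs, hbud.trans (mul_le_mul_of_nonneg_right hle (integral_rho_pos D (k + 1 + n) (g₀ (k + 1 + n))).le)⟩

/-- HYPOTHESIS SHAPE — (W1) WITH A SUMMABLE ENVELOPE, CURRENCY-FREE: per string there is `A ≥ 0` summable with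
`StepDefectBudget D g₀ Cs (A n) k n` for every step `k` and distance `n` — the (0.3)-terms' one-term defects of the pulled-back
loop product have `Σ_Z |termDefect_Z| ≤ A n·∫ρ_K`, the constant depending on the DISTANCE only and summably.  Weaker than
`UniformDefectBudget` (`A n = C·rⁿ`).  NOT PRINTED, never asserted. [folklore] -/
def SummableDefectBudget (D : FiniteEpsData F G) (g₀ : ℕ → ℝ) : Prop :=
  ∀ Cs : List (ULoop F), ∃ A : ℕ → ℝ, (∀ n, 0 ≤ A n) ∧ Summable A ∧ ∀ k n, StepDefectBudget D g₀ Cs (A n) k n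

/-- HYPOTHESIS SHAPE — (W1) WITH A SUMMABLE ENVELOPE IN THE EXTERIOR-COVARIANCE CURRENCY: per string there is `A ≥ 0`
summable with `StepCovBudget D g₀ Cs (A n) k n` for every `k, n` — mass-weighted exterior covariances plus second-order
remainders with a distance-only, summable budget (generation 7's `UniformCovDefect` with `C·rⁿ` relaxed to `A n`; the border
`σ = L⁻¹` of `count_mul_cov_rate_border` with summable large-field step weights is the cell's reading of a supplier, record
§13, [heuristic]).  NOT PRINTED, never asserted. [folklore] -/
def SummableCovDefect (D : FiniteEpsData F G) (g₀ : ℕ → ℝ) : Prop :=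
  ∀ Cs : List (ULoop F), ∃ A : ℕ → ℝ, (∀ n, 0 ≤ A n) ∧ Summable A ∧ ∀ k n, StepCovBudget D g₀ Cs (A n) k n

/-- `UniformDefectBudget ⇒ SummableDefectBudget` (`A n = C·rⁿ`). [folklore] -/
theorem summableDefectBudget_of_uniformDefectBudget (D : FiniteEpsData F G) (g₀ : ℕ → ℝ)
    (h : UniformDefectBudget D g₀) : SummableDefectBudget D g₀ := by
  intro Cs
  obtain ⟨C, r, hC, hr0, hr1, hkn⟩ := h Cs
  exact ⟨fun n => C * r ^ n, fun n => mul_nonneg hC (pow_nonneg hr0 n),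
    (summable_geometric_of_lt_one hr0 hr1).mul_left C, hkn⟩

/-- `UniformCovDefect ⇒ SummableCovDefect` (`A n = C·rⁿ`). [folklore] -/
theorem summableCovDefect_of_uniformCovDefect (D : FiniteEpsData F G) (g₀ : ℕ → ℝ) (h : UniformCovDefect D g₀) :
    SummableCovDefect D g₀ := by
  intro Cs
  obtain ⟨C, r, hC, hr0, hr1, hkn⟩ := h Cs
  exact ⟨fun n => C * r ^ n, fun n => mul_nonneg hC (pow_nonneg hr0 n),
    (summable_geometric_of_lt_one hr0 hr1).mul_left C, hkn⟩

/-- `SummableCovDefect ⇒ SummableDefectBudget` (`stepDefectBudget_of_stepCovBudget` term by term). [folklore] -/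
theorem summableDefectBudget_of_summableCovDefect [RegularGaugeGroup G] (D : FiniteEpsData F G) (hM : D.AvgMeasurable)
    (g₀ : ℕ → ℝ) (h : SummableCovDefect D g₀) : SummableDefectBudget D g₀ := by
  intro Cs
  obtain ⟨A, hA0, hA, hkn⟩ := h Cs
  exact ⟨A, hA0, hA, fun k n => stepDefectBudget_of_stepCovBudget D hM g₀ Cs (hkn k n)⟩

/-- **(W1)-SUMMABLE WIRED: `SummableDefectBudget D g₀ → UniformSummableDefect D g₀`** (every run `K > n` is `k + 1 + n`;
`abs_normDefect_le_of_stepDefectBudget`). [folklore] -/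
theorem uniformSummableDefect_of_summableDefectBudget [RegularGaugeGroup G] (D : FiniteEpsData F G)
    (hM : D.AvgMeasurable) (g₀ : ℕ → ℝ) (h : SummableDefectBudget D g₀) : UniformSummableDefect D g₀ := by
  intro Cs
  obtain ⟨A, hA0, hA, hkn⟩ := h Cs
  refine ⟨A, hA0, hA, fun K n hn => ?_⟩
  obtain ⟨k, rfl⟩ : ∃ k, K = k + 1 + n := ⟨K - 1 - n, by omega⟩
  exact abs_normDefect_le_of_stepDefectBudget D hM g₀ Cs (hkn k n)

/-- `SummableCovDefect ⇒ UniformSummableDefect`. [folklore] -/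
theorem uniformSummableDefect_of_summableCovDefect [RegularGaugeGroup G] (D : FiniteEpsData F G)
    (hM : D.AvgMeasurable) (g₀ : ℕ → ℝ) (h : SummableCovDefect D g₀) : UniformSummableDefect D g₀ :=
  uniformSummableDefect_of_summableDefectBudget D hM g₀ (summableDefectBudget_of_summableCovDefect D hM g₀ h)

/-- **EXISTENCE FROM THE SUMMABLE COVARIANCE DATUM, A RUN LADDER AND THE GOOD/BAD DATUM ALONG IT** (generation 7's
`hasContinuumLimit_of_covDefect_ladder` with the geometric budget relaxed to a summable envelope and `1 ≤ Λ` dropped).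
CONDITIONAL on both shapes, neither printed nor proved for Bałaban's densities. [folklore] -/
theorem hasContinuumLimit_of_summableCovDefect_ladder [RegularGaugeGroup G] (D : FiniteEpsData F G)
    (hM : D.AvgMeasurable) (R : RunLadder D) (g₀ : ℕ → ℝ) (hW : SummableCovDefect D g₀) {C θ E ρ Λ : ℝ} {c : ℕ}
    {inj : ℕ → ℕ → ℝ} (hinj : InjectedRate C c θ inj) (hE : 0 ≤ E) (hθ : 0 ≤ θ) (hθ1 : θ < 1) (hρ : 0 ≤ ρ)
    (hρ1 : ρ < 1) (h : LadderGoodBadRate D R g₀ Λ E ρ inj) : HasContinuumLimit (D.scheme g₀) :=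
  hasContinuumLimit_of_summableDefect_ladder D hM R g₀ (uniformSummableDefect_of_summableCovDefect D hM g₀ hW)
    hinj hE hθ hθ1 hρ hρ1 h

/-- The same from the currency-free summable datum. [folklore] -/
theorem hasContinuumLimit_of_summableDefectBudget_ladder [RegularGaugeGroup G] (D : FiniteEpsData F G)
    (hM : D.AvgMeasurable) (R : RunLadder D) (g₀ : ℕ → ℝ) (hW : SummableDefectBudget D g₀) {C θ E ρ Λ : ℝ} {c : ℕ}
    {inj : ℕ → ℕ → ℝ} (hinj : InjectedRate C c θ inj) (hE : 0 ≤ E) (hθ : 0 ≤ θ) (hθ1 : θ < 1) (hρ : 0 ≤ ρ)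
    (hρ1 : ρ < 1) (h : LadderGoodBadRate D R g₀ Λ E ρ inj) : HasContinuumLimit (D.scheme g₀) :=
  hasContinuumLimit_of_summableDefect_ladder D hM R g₀ (uniformSummableDefect_of_summableDefectBudget D hM g₀ hW)
    hinj hE hθ hθ1 hρ hρ1 h

/-- **MID-LEVEL LIMITS + A SUMMABLE STEP BUDGET ⇒ EXISTENCE** — the schedule-free end-to-end form: a supplier of per-step
(0.3)-term budgets with a summable distance-envelope and of the fixed-distance limits of the effective expectations closes
rung (B)+1's existence clause along this lane. CONDITIONAL on both shapes. [folklore] -/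
theorem hasContinuumLimit_of_summableDefectBudget_midLimits [RegularGaugeGroup G] (D : FiniteEpsData F G)
    (hM : D.AvgMeasurable) (g₀ : ℕ → ℝ) (hW : SummableDefectBudget D g₀) (hL : MidLimits D g₀) :
    HasContinuumLimit (D.scheme g₀) :=
  hasContinuumLimit_of_summableDefect_midLimits D hM g₀ (uniformSummableDefect_of_summableDefectBudget D hM g₀ hW) hL

end Supplier

end Literature.MathematicalPhysics.QuantumFieldTheory.Balaban1983to89.T4SummableDefect
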